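import Mathlib
import Summits.MatrixMultiplication.MatrixMultiplication.Theses.LevelGradedCohnUmans

/-!
# `SnLevelDesigns` (stmt-MatrixMultiplication-7613), line `garnir-annihilator`: S4 `stub_shellInterpolation` — shell interpolation (RSS 2009 Thm 2 at `(n-k,1^k)`, elementary proof)

Crux `Summit.MatrixMultiplication.MatrixMultiplication.Theses.LevelGradedCohnUmans.SnLevelDesigns`; skeleton
`Cruxes/SnLevelDesigns/Lines/garnir-annihilator.lean` (lead reshape, 7 registered stubs); this file proves the registered stub
`stub_shellInterpolation` verbatim (name + signature, tree-only vocabulary) and lands `--supports stmt-MatrixMultiplication-7613`.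

For `k ≤ n`, every function on the Schensted shell `B_k = {g : lis g ≥ n-k}` is the restriction of a `k`-token
function `g ↦ Σ_p c p (g ∘ p)`. Elementary proof (no RSK, no dimension count): for `b ∈ B_k` fix an increasing
position set `S_b`, `|S_b| = n - k`, and `T_b = [n] ∖ S_b` (`|T_b| = k`, enumerated by a tuple `a_b : Fin k → Fin n`);
the `k`-coset `C_b = {g : g ∘ a_b = b ∘ a_b}` (agree with `b` on `T_b`) has `b` as its UNIQUE maximum of the
position weight `Φ(w) = Σ_i i·w(i)`: any other `g ∈ C_b` is `b ∘ σ` with `σ` supported on `S_b`, so the strict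
rearrangement inequality (`MonovaryOn.sum_smul_comp_perm_lt_sum_smul_iff`) gives `Φ g < Φ b` unless `g` is
increasing on `S_b`, and the increasing arrangement agreeing with `b` off `S_b` is unique (`si_eq_of_agree_off`,
well-founded induction on the position). Hence the coset indicators `1_{C_b}` (token tables
`c p q := [p = a_b ∧ q = b ∘ a_b]`) restricted to `B_k` are unitriangular for the `Φ`-order, and one interpolates
by `Finset.induction_on_min_value Φ`: inserting a `Φ`-minimal `b`, put `c' := c + (v b - f_c b) · 1_{C_b}`; the
correction vanishes at every previously inserted `g` (`Φ g ≥ Φ b`, `g ≠ b`, so `g ∉ C_b`).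
-/

set_option linter.dupNamespace false

namespace Summit.MatrixMultiplication.MatrixMultiplication.Theorems.SnLevelDesigns

open scoped BigOperators

/-- Half of the uniqueness of increasing arrangements: if `b` is increasing on `S`, `g` agrees with `b`
off `S` and below `x ∈ S`, then `g x < b x` is impossible (the `b`-preimage `z` of `g x` would lie in `S`
strictly below `x`, where `g z = b z = g x` contradicts injectivity). -/
theorem si_not_lt_of_agree_below {n : ℕ} {S : Finset (Fin n)} {g b : Equiv.Perm (Fin n)}
    (hb : StrictMonoOn (⇑b) (S : Set (Fin n))) (hoff : ∀ x ∉ S, g x = b x) {x : Fin n}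
    (hx : x ∈ S) (ih : ∀ y < x, g y = b y) : ¬ g x < b x := by
  intro hlt
  obtain ⟨z, hbz⟩ : ∃ z, b z = g x := ⟨b.symm (g x), b.apply_symm_apply _⟩
  have hzS : z ∈ S := by
    by_contra hzS
    have h := hoff z hzS
    rw [hbz] at h
    exact hzS ((g.injective h) ▸ hx)
  have hzx : z < x := by
    rcases lt_trichotomy z x with h | h | h
    · exact h
    · subst h
      rw [hbz] at hlt
      exact absurd hlt (lt_irrefl _)
    · exact absurd (hlt.trans (lt_of_lt_of_eq (hb hx hzS h) hbz)) (lt_irrefl _)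
  have h := ih z hzx
  rw [hbz] at h
  exact absurd (g.injective h) (ne_of_lt hzx)

/-- Uniqueness of increasing arrangements: two permutations that are both increasing on `S` and agree
off `S` are equal (well-founded induction on the position, using `si_not_lt_of_agree_below` twice). -/
theorem si_eq_of_agree_off {n : ℕ} (S : Finset (Fin n)) {g b : Equiv.Perm (Fin n)}
    (hg : StrictMonoOn (⇑g) (S : Set (Fin n))) (hb : StrictMonoOn (⇑b) (S : Set (Fin n)))
    (hoff : ∀ x ∉ S, g x = b x) : g = b := by
  apply Equiv.ext
  intro x
  induction x using WellFoundedLT.induction with | ind x ih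
  by_cases hx : x ∈ S
  · rcases lt_trichotomy (g x) (b x) with h | h | h
    · exact absurd h (si_not_lt_of_agree_below hb hoff hx ih)
    · exact h
    · exact absurd h (si_not_lt_of_agree_below hg (fun y hy => (hoff y hy).symm) hx
        (fun y hy => (ih y hy).symm))
  · exact hoff x hx

/-- KEY (unitriangularity): if `b` is increasing on `S` and `g ≠ b` agrees with `b` off `S`, then the
position weight `Φ(w) = Σ_i i·w(i)` satisfies `Φ g < Φ b` (strict rearrangement inequality for the
permutation `b⁻¹ * g`, which is supported on `S`; equality would force `g` increasing on `S`, hence `g = b`). -/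
theorem si_weight_lt_of_agree_off {n : ℕ} {S : Finset (Fin n)} {g b : Equiv.Perm (Fin n)}
    (hb : StrictMonoOn (⇑b) (S : Set (Fin n))) (hoff : ∀ x ∉ S, g x = b x) (hne : g ≠ b) :
    (∑ i : Fin n, (i : ℕ) * ((g i : Fin n) : ℕ)) < ∑ i : Fin n, (i : ℕ) * ((b i : Fin n) : ℕ) := by
  classical
  have hσ : ∀ x, b ((b⁻¹ * g) x) = g x := fun x => by simp [Equiv.Perm.mul_apply]
  have hsupp : {x | (b⁻¹ * g) x ≠ x} ⊆ (S : Set (Fin n)) := by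
    intro x hx
    by_contra hxS
    exact absurd (b.injective (by rw [hσ, hoff x hxS]) : (b⁻¹ * g) x = x) hx
  have hmono : MonovaryOn (fun i : Fin n => (i : ℕ)) (fun i => ((b i : Fin n) : ℕ))
      (S : Set (Fin n)) := by
    intro i hi j hj hij
    exact not_lt.mp fun hlt =>
      absurd (Fin.lt_def.mpr hij) (not_lt.mpr (hb hj hi (Fin.lt_def.mpr hlt)).le)
  have hnm : ¬ MonovaryOn (fun i : Fin n => (i : ℕ))
      ((fun i => ((b i : Fin n) : ℕ)) ∘ ⇑(b⁻¹ * g)) (S : Set (Fin n)) := by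
    intro hmono'
    refine hne (si_eq_of_agree_off S ?_ hb hoff)
    intro i hi j hj hij
    rcases lt_or_gt_of_ne (fun h : g i = g j => (ne_of_lt hij) (g.injective h)) with h | h
    · exact h
    · have h2 : ((fun i => ((b i : Fin n) : ℕ)) ∘ ⇑(b⁻¹ * g)) j <
          ((fun i => ((b i : Fin n) : ℕ)) ∘ ⇑(b⁻¹ * g)) i := by
        show ((b ((b⁻¹ * g) j) : Fin n) : ℕ) < ((b ((b⁻¹ * g) i) : Fin n) : ℕ)
        rw [hσ, hσ]
        exact Fin.lt_def.mp h
      exact absurd hij (not_lt.mpr (Fin.le_def.mpr (hmono' hj hi h2)))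
  have hlt : (∑ i ∈ S, (i : ℕ) • ((b ((b⁻¹ * g) i) : Fin n) : ℕ)) <
      ∑ i ∈ S, (i : ℕ) • ((b i : Fin n) : ℕ) :=
    (hmono.sum_smul_comp_perm_lt_sum_smul_iff hsupp).mpr hnm
  simp only [smul_eq_mul, hσ] at hlt
  rw [← Finset.sum_add_sum_compl S, ← Finset.sum_add_sum_compl S]
  have hcompl : (∑ i ∈ Sᶜ, (i : ℕ) * ((g i : Fin n) : ℕ)) = ∑ i ∈ Sᶜ, (i : ℕ) * ((b i : Fin n) : ℕ) :=
    Finset.sum_congr rfl fun i hi => by rw [hoff i (Finset.mem_compl.mp hi)]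
  rw [hcompl]
  exact Nat.add_lt_add_right hlt _

/-- Coset data of a shell element: from an increasing set of size `≥ n - k` extract an increasing set `S`
of size exactly `n - k` and a `k`-tuple enumerating its complement. -/
theorem si_exists_cosetData {n k : ℕ} (hk : k ≤ n) {a : Equiv.Perm (Fin n)}
    (hsh : ∃ s : Finset (Fin n), n - k ≤ s.card ∧ StrictMonoOn (⇑a) (s : Set (Fin n))) :
    ∃ (S : Finset (Fin n)) (tup : Fin k → Fin n), StrictMonoOn (⇑a) (S : Set (Fin n)) ∧
      (∀ i, tup i ∉ S) ∧ (∀ x ∉ S, ∃ i, tup i = x) := by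
  classical
  obtain ⟨s, hcard, hmono⟩ := hsh
  obtain ⟨S, hSs, hScard⟩ := Finset.exists_subset_card_eq hcard
  have hT : Sᶜ.card = k := by
    rw [Finset.card_compl, Fintype.card_fin, hScard]
    omega
  refine ⟨S, fun i => (Sᶜ.orderIsoOfFin hT i).1, hmono.mono (Finset.coe_subset.mpr hSs),
    fun i => Finset.mem_compl.mp (Sᶜ.orderIsoOfFin hT i).2, fun x hx => ?_⟩
  exact ⟨(Sᶜ.orderIsoOfFin hT).symm ⟨x, Finset.mem_compl.mpr hx⟩, by simp⟩

/-- **`stub_shellInterpolation`** (registered stub of crux stmt-MatrixMultiplication-7613, line `garnir-annihilator`).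
For `k ≤ n`, every function on the Schensted shell `B_k = {g : lis g ≥ n-k}` is the restriction of a `k`-token
function `g ↦ Σ_p c p (g ∘ p)` (Raghavan–Samuel–Subrahmanyam 2009, Thm 2 at the hook `(n-k,1^k)`; elementary
proof by `Φ`-unitriangularity of the coset indicators, see the module docstring). -/
theorem stub_shellInterpolation :
    ∀ (n k : ℕ), k ≤ n → ∀ v : Equiv.Perm (Fin n) → ℂ,
      ∃ c : (Fin k → Fin n) → (Fin k → Fin n) → ℂ,
        ∀ g : Equiv.Perm (Fin n),
          (∃ s : Finset (Fin n), n - k ≤ s.card ∧ StrictMonoOn (⇑g) (s : Set (Fin n))) →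
            (∑ p : Fin k → Fin n, c p (⇑g ∘ p)) = v g := by
  intro n k hk v
  classical
  suffices main : ∀ B : Finset (Equiv.Perm (Fin n)),
      ∃ c : (Fin k → Fin n) → (Fin k → Fin n) → ℂ, ∀ g ∈ B,
        (∃ s : Finset (Fin n), n - k ≤ s.card ∧ StrictMonoOn (⇑g) (s : Set (Fin n))) →
          (∑ p : Fin k → Fin n, c p (⇑g ∘ p)) = v g by
    obtain ⟨c, hc⟩ := main Finset.univ
    exact ⟨c, fun g hg => hc g (Finset.mem_univ g) hg⟩
  intro B
  induction B using Finset.induction_on_min_value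
    (fun w : Equiv.Perm (Fin n) => ∑ i : Fin n, (i : ℕ) * ((w i : Fin n) : ℕ)) with
  | empty => exact ⟨fun _ _ => 0, fun g hg => absurd hg (Finset.notMem_empty g)⟩
  | insert a s has hmin ih =>
    obtain ⟨c, hc⟩ := ih
    by_cases hsh : ∃ t : Finset (Fin n), n - k ≤ t.card ∧ StrictMonoOn (⇑a) (t : Set (Fin n))
    · obtain ⟨S, tup, hSmono, htupS, htsurj⟩ := si_exists_cosetData hk hsh
      refine ⟨fun p q => c p q +
        (if p = tup ∧ q = ⇑a ∘ tup then v a - ∑ p' : Fin k → Fin n, c p' (⇑a ∘ p') else 0), ?_⟩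
      intro g hg hshg
      have hind : (∑ p : Fin k → Fin n, (if p = tup ∧ ⇑g ∘ p = ⇑a ∘ tup then
          v a - ∑ p' : Fin k → Fin n, c p' (⇑a ∘ p') else 0)) =
          if ⇑g ∘ tup = ⇑a ∘ tup then v a - ∑ p' : Fin k → Fin n, c p' (⇑a ∘ p') else 0 := by
        rw [Finset.sum_eq_single tup]
        · simp
        · intro p _ hp
          simp [hp]
        · intro h
          exact absurd (Finset.mem_univ tup) h
      rw [Finset.sum_add_distrib, hind]
      rcases Finset.mem_insert.mp hg with rfl | hgs
      · simp
      · have hga : g ≠ a := fun h => has (h ▸ hgs)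
        rw [hc g hgs hshg, if_neg, add_zero]
        intro hagree
        have hoff : ∀ x ∉ S, g x = a x := fun x hx => by
          obtain ⟨i, rfl⟩ := htsurj x hx
          exact congrFun hagree i
        exact absurd (hmin g hgs) (not_le.mpr (si_weight_lt_of_agree_off hSmono hoff hga))
    · exact ⟨c, fun g hg hshg => hc g ((Finset.mem_insert.mp hg).resolve_left
        (by rintro rfl; exact hsh hshg)) hshg⟩

end Summit.MatrixMultiplication.MatrixMultiplication.Theorems.SnLevelDesigns
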